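import Literature.Barriers.RiemannHypothesis.EpsteinZetaStarkCount
import Literature.Barriers.RiemannHypothesis.EpsteinZetaCentralValueSharp
import Mathlib.Analysis.SpecialFunctions.Pow.Asymptotics
import HarnessLib

/-!
# Stark's theorem on the zeros of Epstein zeta functions, V: proof of `Stark1967_thm1` and of the barrier `EpsteinZetaRealZeros`

Eighth (and last) proof file next to `Literature/Barriers/RiemannHypothesis/EpsteinZetaRealZeros.lean`:
`Literature.Barriers.RiemannHypothesis.Stark1967_thm1_holds` and
`Literature.Barriers.RiemannHypothesis.EpsteinZetaRealZeros_holds`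
(`EpsteinZetaRealZeros = BatemanGrosswald1964_realZero ∧ Stark1967_thm1`, the first conjunct being
`Literature.Barriers.RiemannHypothesis.BatemanGrosswald1964_realZero_holds`).

The argument is Stark's (§4), with the count of Lemma 5 taken from
`Literature.Barriers.RiemannHypothesis.finsum_order_epsteinP_eq` (where Stark's Lemmas 1, 2, 4 — which
use the Vinogradov zero-free region — are replaced by the Lagarias–Suzuki domination
`|f(1−s)| ≤ k^{1−2σ}|s/(s−1)||f(s)|`, `EpsteinZetaStarkSetup.lean`): for `k` large and
`T₀ ∈ [2k, 2k+50]` with `θ_k(T₀) = 2πm` (`Literature.Barriers.RiemannHypothesis.exists_starkT₀`),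

* the Rouché inequalities `|P_z − M_z| = |s(s−1)E_z| < |M_z|` on `2 → 2+iT₀ → ½+iT₀` and
  `|E_z| < 4|f|` on the critical segment follow from `|E_z| ≤ 48√k e^{−1.4πk}`
  (`EpsteinZetaConstantTerms.lean`) against the lower bounds of `EpsteinZetaStarkEdges.lean`
  (all of size `≥ k^{−A} e^{−πk − 25π}`);
* `P_z` has `4m + 2` zeros in `(−1, 2) × (−T₀, T₀)` counted with multiplicity (Lemma 5);
* `P_z(½ + it)` is real and has the sign of `−cos θ_k(t)` whenever `θ_k(t) ∈ πℤ`, so the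
  intermediate value theorem produces `2m` distinct zeros `½ + iv`, `0 < v < T₀`, hence with their
  conjugates and the Bateman–Grosswald pair `β₂ ∈ (½, 1)`, `β₁ = 1 − β₂`
  (`Literature.Barriers.RiemannHypothesis.BatemanGrosswald1964_realZero_holds`) `4m + 2` distinct
  zeros: so these are all the zeros and all are simple (§4, last paragraph);
* finally every continuation `Z` of `ζ_Q` equals `π^s (√|d|/2)^{−s} Γ(s+1)⁻¹ (s−1)⁻¹ P_{z'}(s)` on
  `Re s > −1`, `s ≠ 1` (`z' = (b + i√|d|)/(2a)`, `Im z' = k`), transferring zeros and simplicity.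

`K` is ineffective here exactly as in Stark's statement ("There exists a number `K`"): it is
extracted from finitely many `k → ∞` limits.

## References

* [Stark1967EpsteinZeros] H. M. Stark, Mathematika 14 (1967) 47–55, Theorem 1, §3 Lemmas 3, 5, §4.
* [BatemanGrosswald1964] P. T. Bateman, E. Grosswald, Acta Arith. 9 (1964) 365–373, Theorem 3.
* [LagariasSuzuki2006] J. C. Lagarias, M. Suzuki, J. Number Theory 118 (2006) 98–122, Theorem 2.1.
-/

noncomputable section

open Complex Filter Topology Set MeasureTheory intervalIntegral Metric HurwitzZeta Asymptotics

open scoped UpperHalfPlane Real ComplexConjugate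

namespace Literature.Barriers.RiemannHypothesis

open Literature.NumberTheory.Automorphic
open Literature.NumberTheory.LFunctions
open Literature.Analysis.Complex
open Literature.Analysis.SpecialFunctions

/-! ## Two generic lemmas -/

/-- **Alternation and the intermediate value theorem.** If `θ, g` are continuous, `θ(a) ≤ 0`,
`θ(b) ≥ nπ`, and `(−1)^j g(t) < 0` whenever `θ(t) = jπ` (`t ∈ [a, b]`, `j ∈ ℕ`), then `g` has `n`
distinct zeros in `(a, b)`. (Stark §4: "there is a zero of `α(½ + it)` between `t_{2j}` and
`t_{2j+1}`".) [cite: Stark1967EpsteinZeros, §4] -/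
theorem exists_finset_zeros_of_alternating {θ g : ℝ → ℝ} (hθ : Continuous θ) (hg : Continuous g) :
    ∀ (n : ℕ) (a b : ℝ), a ≤ b → θ a ≤ 0 → (n : ℝ) * π ≤ θ b →
      (∀ t ∈ Icc a b, ∀ j : ℕ, θ t = j * π → (-1) ^ j * g t < 0) →
      ∃ S : Finset ℝ, (↑S ⊆ Ioo a b) ∧ S.card = n ∧ ∀ v ∈ S, g v = 0 := by
  intro n
  induction n with
  | zero => intro a b _ _ _ _; exact ⟨∅, by simp, by simp, by simp⟩
  | succ n ih =>
    intro a b hab hθa hθb halt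
    have hπ := Real.pi_pos
    have hn0 : (0 : ℝ) ≤ n * π := by positivity
    push_cast at hθb
    obtain ⟨t', ht', hθt'⟩ : ∃ t' ∈ Icc a b, θ t' = n * π :=
      intermediate_value_Icc hab hθ.continuousOn ⟨by linarith, by nlinarith⟩
    obtain ⟨S, hS, hcard, hzero⟩ := ih a t' ht'.1 hθa hθt'.ge
      (fun t ht j hj ↦ halt t ⟨ht.1, ht.2.trans ht'.2⟩ j hj)
    obtain ⟨t'', ht'', hθt''⟩ : ∃ t'' ∈ Icc t' b, θ t'' = (n + 1 : ℕ) * π :=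
      intermediate_value_Icc ht'.2 hθ.continuousOn ⟨by rw [hθt']; push_cast; nlinarith, by push_cast; exact hθb⟩
    have hlt : t' < t'' := by
      rcases ht''.1.eq_or_lt with h | h
      · exfalso; rw [← h, hθt'] at hθt''; push_cast at hθt''; nlinarith
      · exact h
    have h1 := halt t' ht' n hθt'
    have h2 := halt t'' ⟨ht'.1.trans ht''.1, ht''.2⟩ (n + 1) hθt''
    rw [pow_succ] at h2
    have hsq : ((-1 : ℝ) ^ n) ^ 2 = 1 := by rw [← pow_mul, mul_comm, pow_mul]; simp
    have hprod : g t' * g t'' < 0 := by nlinarith [mul_pos_of_neg_of_neg h1 h2, hsq]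
    obtain ⟨v, hv, hgv⟩ : ∃ v ∈ Ioo t' t'', g v = 0 := by
      have hg0 : g t' ≠ 0 := fun h ↦ by rw [h, zero_mul] at hprod; exact lt_irrefl _ hprod
      rcases lt_or_gt_of_ne hg0 with hneg | hpos
      · have hpos' : 0 < g t'' := by nlinarith
        exact intermediate_value_Ioo hlt.le hg.continuousOn ⟨hneg, hpos'⟩
      · have hneg' : g t'' < 0 := by nlinarith
        exact intermediate_value_Ioo' hlt.le hg.continuousOn ⟨hneg', hpos⟩
    refine ⟨insert v S, ?_, ?_, ?_⟩
    · intro w hw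
      rw [Finset.coe_insert, Set.mem_insert_iff] at hw
      rcases hw with rfl | hw
      · exact ⟨lt_of_le_of_lt ht'.1 hv.1, lt_of_lt_of_le hv.2 ht''.2⟩
      · have := hS hw
        exact ⟨this.1, this.2.trans_le ht'.2⟩
    · rw [Finset.card_insert_of_notMem, hcard]
      intro hvS
      exact absurd (hS hvS).2 (not_lt.2 hv.1.le)
    · intro w hw
      rw [Finset.mem_insert] at hw
      rcases hw with rfl | hw
      · exact hgv
      · exact hzero w hw

/-- A zero of order exactly `1` of an analytic function is a simple zero: `f'(z₀) ≠ 0`. [folklore] -/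
theorem deriv_ne_zero_of_analyticOrderAt_eq_one {f : ℂ → ℂ} {z₀ : ℂ} (hf : AnalyticAt ℂ f z₀)
    (h : analyticOrderAt f z₀ = 1) : deriv f z₀ ≠ 0 := by
  obtain ⟨g, hg, hg0, hfg⟩ := (hf.analyticOrderAt_eq_natCast (n := 1)).1 (by exact_mod_cast h)
  have hfg' : f =ᶠ[𝓝 z₀] fun z ↦ (z - z₀) * g z := by
    filter_upwards [hfg] with z hz
    rw [hz, pow_one, smul_eq_mul]
  have hd : HasDerivAt ((fun x ↦ x - z₀) * g) (g z₀) z₀ := by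
    have := ((hasDerivAt_id z₀).sub_const z₀).mul hg.differentiableAt.hasDerivAt
    simpa using this
  have e : (fun z ↦ (z - z₀) * g z) = (fun x ↦ x - z₀) * g := rfl
  rw [hfg'.deriv_eq, e, hd.deriv]
  exact hg0

/-! ## Every continuation of `ζ_Q` in closed form on `Re s > −1` -/

/-! Below `C(s)` abbreviates the entire-away-from-`1` prefactor `π^s (√|d|/2)^{−s} Γ(s+1)⁻¹ (s−1)⁻¹`
(`|d| = 4ac − b²`), written out, so that `ζ_Q(s) = C(s) P_{z'}(s)`. -/

/-- `C` is complex differentiable away from `s = 1`. [folklore] -/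
theorem differentiableAt_starkC {a b c : ℝ} (h : IsPosDefForm a b c) {s : ℂ} (h1 : s ≠ 1) :
    DifferentiableAt ℂ (fun w : ℂ ↦ (Real.pi : ℂ) ^ w * ((Real.sqrt (4 * c * a - b ^ 2) / 2 : ℝ) : ℂ) ^ (-w) *
      (Complex.Gamma (w + 1))⁻¹ * (w - 1)⁻¹) s := by
  have hD := h.swap.four_ac_sub_sq_pos
  have hX : ((Real.sqrt (4 * c * a - b ^ 2) / 2 : ℝ) : ℂ) ≠ 0 := by
    have : 0 < Real.sqrt (4 * c * a - b ^ 2) / 2 := by positivity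
    exact_mod_cast this.ne'
  have hπ : (Real.pi : ℂ) ≠ 0 := by exact_mod_cast Real.pi_pos.ne'
  refine (((differentiableAt_id.const_cpow (Or.inl hπ)).mul
    (differentiableAt_id.neg.const_cpow (Or.inl hX))).mul ?_).mul
    ((differentiableAt_id.sub_const 1).inv (sub_ne_zero.2 h1))
  exact (Complex.differentiable_one_div_Gamma.comp (differentiable_id.add_const 1)) s

/-- `C(s) ≠ 0` for `Re s > −1`, `s ≠ 1`. [folklore] -/
theorem starkC_ne_zero {a b c : ℝ} (h : IsPosDefForm a b c) {s : ℂ} (hs : -1 < s.re) (h1 : s ≠ 1) :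
    ((Real.pi : ℂ) ^ s * ((Real.sqrt (4 * c * a - b ^ 2) / 2 : ℝ) : ℂ) ^ (-s) * (Complex.Gamma (s + 1))⁻¹ * (s - 1)⁻¹) ≠ 0 := by
  have hD := h.swap.four_ac_sub_sq_pos
  have hX : ((Real.sqrt (4 * c * a - b ^ 2) / 2 : ℝ) : ℂ) ≠ 0 := by
    have : 0 < Real.sqrt (4 * c * a - b ^ 2) / 2 := by positivity
    exact_mod_cast this.ne'
  have hπ : (Real.pi : ℂ) ≠ 0 := by exact_mod_cast Real.pi_pos.ne'
  have hΓ : Complex.Gamma (s + 1) ≠ 0 := by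
    refine Complex.Gamma_ne_zero fun m hm ↦ ?_
    have := congrArg Complex.re hm
    simp at this
    linarith [(m.cast_nonneg : (0 : ℝ) ≤ m)]
  refine mul_ne_zero (mul_ne_zero (mul_ne_zero ?_ ?_) (inv_ne_zero hΓ)) (inv_ne_zero (sub_ne_zero.2 h1))
  · rw [Ne, Complex.cpow_eq_zero_iff]; exact fun h' ↦ hπ h'.1
  · rw [Ne, Complex.cpow_eq_zero_iff]; exact fun h' ↦ hX h'.1

/-- **Closed form of the continuations off `s = 0`**: for `s ≠ 0, 1` with `Γ(s) ≠ 0`,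
`Z(s) = C(s) P_{z'}(s)`, `z' = (b + i√|d|)/(2a)` (`Im z' = k`). From
`Literature.Barriers.RiemannHypothesis.exists_continuation_eq_Λ` for the swapped form `(c, b, a)`,
uniqueness of the continuation, and `P = s(s−1)Λ`, `Γ(s+1) = sΓ(s)`.
[cite: Stark1967EpsteinZeros, §2 (5)–(9)] -/
theorem continuation_eq_starkC_mul_of_ne_zero {a b c : ℝ} (h : IsPosDefForm a b c) (z : ℍ)
    (hre : z.re = b / (2 * a)) (him : z.im = Real.sqrt (4 * c * a - b ^ 2) / (2 * a))
    {Z : ℂ → ℂ} (hZ : IsEpsteinContinuation a b c Z) {s : ℂ} (h0 : s ≠ 0) (h1 : s ≠ 1)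
    (hΓ : Complex.Gamma s ≠ 0) : Z s = ((Real.pi : ℂ) ^ s * ((Real.sqrt (4 * c * a - b ^ 2) / 2 : ℝ) : ℂ) ^ (-s) * (Complex.Gamma (s + 1))⁻¹ * (s - 1)⁻¹) * epsteinP z s := by
  obtain ⟨W, hW, hWeq⟩ := exists_continuation_eq_Λ h.swap z hre him
  have hW' : IsEpsteinContinuation a b c W := (isEpsteinContinuation_swap_iff a b c W).1 hW
  rw [hZ.eqOn hW' (show s ∈ {s : ℂ | s ≠ 1} from h1), hWeq s h0 h1 hΓ, epsteinP_eq_mul_Λ z h0 h1,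
    Complex.Gamma_add_one s h0]
  have h1' : s - 1 ≠ 0 := sub_ne_zero.2 h1
  field_simp

/-- **Closed form of the continuations**: `Z(s) = C(s) P_{z'}(s)` for all `Re s > −1`, `s ≠ 1`
(at `s = 0` by continuity: both sides are continuous and agree on a punctured neighbourhood; the
value is `ζ_Q(0) = −1`). [cite: Stark1967EpsteinZeros, §2 (5)–(9)] -/
theorem continuation_eq_starkC_mul {a b c : ℝ} (h : IsPosDefForm a b c) (z : ℍ)
    (hre : z.re = b / (2 * a)) (him : z.im = Real.sqrt (4 * c * a - b ^ 2) / (2 * a))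
    {Z : ℂ → ℂ} (hZ : IsEpsteinContinuation a b c Z) {s : ℂ} (hs : -1 < s.re) (h1 : s ≠ 1) :
    Z s = ((Real.pi : ℂ) ^ s * ((Real.sqrt (4 * c * a - b ^ 2) / 2 : ℝ) : ℂ) ^ (-s) * (Complex.Gamma (s + 1))⁻¹ * (s - 1)⁻¹) * epsteinP z s := by
  by_cases h0 : s = 0
  · subst h0
    set R : ℂ → ℂ := fun w ↦ ((Real.pi : ℂ) ^ w * ((Real.sqrt (4 * c * a - b ^ 2) / 2 : ℝ) : ℂ) ^ (-w) * (Complex.Gamma (w + 1))⁻¹ * (w - 1)⁻¹) * epsteinP z w with hR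
    have hZc : ContinuousAt Z 0 :=
      (hZ.1.differentiableAt (isOpen_ne.mem_nhds (by norm_num : (0 : ℂ) ≠ 1))).continuousAt
    have hRc : ContinuousAt R 0 :=
      ((differentiableAt_starkC h (by norm_num)).mul (differentiable_epsteinP z 0)).continuousAt
    have hev : Z =ᶠ[𝓝[≠] (0 : ℂ)] R := by
      rw [Filter.EventuallyEq, eventually_nhdsWithin_iff]
      have h1 : ∀ᶠ w in 𝓝 (0 : ℂ), -1 < w.re :=
        (continuous_re.isOpen_preimage _ isOpen_Ioi).mem_nhds (by simp)
      have h2 : ∀ᶠ w in 𝓝 (0 : ℂ), ‖w‖ < 1 := by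
        simpa [dist_eq_norm] using eventually_nhds_iff_ball.2 ⟨1, one_pos, fun w hw ↦ by simpa using hw⟩
      filter_upwards [h1, h2, eventually_ne_nhds (by norm_num : (0 : ℂ) ≠ 1)] with w hw1 hw2 hw3 hw0
      refine continuation_eq_starkC_mul_of_ne_zero h z hre him hZ hw0 hw3 ?_
      refine Complex.Gamma_ne_zero fun m hm ↦ ?_
      rcases m with _ | m
      · exact hw0 (by simpa using hm)
      · have := congrArg Complex.re hm
        simp at this
        linarith [(m.cast_nonneg : (0 : ℝ) ≤ m)]
    exact tendsto_nhds_unique_of_eventuallyEq hZc.continuousWithinAt.tendsto hRc.continuousWithinAt.tendsto hev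
  · refine continuation_eq_starkC_mul_of_ne_zero h z hre him hZ h0 h1 ?_
    refine Complex.Gamma_ne_zero fun m hm ↦ ?_
    rcases m with _ | m
    · exact h0 (by simpa using hm)
    · have := congrArg Complex.re hm
      simp at this
      linarith [(m.cast_nonneg : (0 : ℝ) ≤ m)]

/-- Zeros of a continuation in `Re s > −1`, `s ≠ 1`, are exactly the zeros of `P_{z'}`.
[cite: Stark1967EpsteinZeros, §2] -/
theorem continuation_eq_zero_iff {a b c : ℝ} (h : IsPosDefForm a b c) (z : ℍ)
    (hre : z.re = b / (2 * a)) (him : z.im = Real.sqrt (4 * c * a - b ^ 2) / (2 * a))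
    {Z : ℂ → ℂ} (hZ : IsEpsteinContinuation a b c Z) {s : ℂ} (hs : -1 < s.re) (h1 : s ≠ 1) :
    Z s = 0 ↔ epsteinP z s = 0 := by
  rw [continuation_eq_starkC_mul h z hre him hZ hs h1, mul_eq_zero, or_iff_right (starkC_ne_zero h hs h1)]

/-- At a zero `s` (`Re s > −1`, `s ≠ 1`): `Z'(s) = C(s) P_{z'}'(s)`, so simplicity transfers.
[cite: Stark1967EpsteinZeros, §4] -/
theorem deriv_continuation_ne_zero {a b c : ℝ} (h : IsPosDefForm a b c) (z : ℍ)
    (hre : z.re = b / (2 * a)) (him : z.im = Real.sqrt (4 * c * a - b ^ 2) / (2 * a))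
    {Z : ℂ → ℂ} (hZ : IsEpsteinContinuation a b c Z) {s : ℂ} (hs : -1 < s.re) (h1 : s ≠ 1)
    (hP : epsteinP z s = 0) (hP' : deriv (epsteinP z) s ≠ 0) : deriv Z s ≠ 0 := by
  have hev : Z =ᶠ[𝓝 s] fun w ↦ ((Real.pi : ℂ) ^ w * ((Real.sqrt (4 * c * a - b ^ 2) / 2 : ℝ) : ℂ) ^ (-w) * (Complex.Gamma (w + 1))⁻¹ * (w - 1)⁻¹) * epsteinP z w := by
    have h1' : ∀ᶠ w in 𝓝 s, -1 < w.re :=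
      (continuous_re.isOpen_preimage _ isOpen_Ioi).mem_nhds (by simpa using hs)
    filter_upwards [h1', eventually_ne_nhds h1] with w hw hw1
    exact continuation_eq_starkC_mul h z hre him hZ hw hw1
  rw [hev.deriv_eq]
  have hd := ((differentiableAt_starkC h h1).hasDerivAt.mul (differentiable_epsteinP z s).hasDerivAt).deriv
  rw [show (fun w : ℂ ↦ ((Real.pi : ℂ) ^ w * ((Real.sqrt (4 * c * a - b ^ 2) / 2 : ℝ) : ℂ) ^ (-w) * (Complex.Gamma (w + 1))⁻¹ * (w - 1)⁻¹) * epsteinP z w) =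
      (fun w : ℂ ↦ (Real.pi : ℂ) ^ w * ((Real.sqrt (4 * c * a - b ^ 2) / 2 : ℝ) : ℂ) ^ (-w) *
      (Complex.Gamma (w + 1))⁻¹ * (w - 1)⁻¹) * epsteinP z from rfl, hd, hP, mul_zero,
    zero_add]
  exact mul_ne_zero (starkC_ne_zero h hs h1) hP'

/-! ## The sign of `P_z(½ + it)` and the `2m` zeros on the critical segment -/

/-- **`P_z(½ + it)` has the sign of `−cos θ_k(t)` when `θ_k(t) ∈ πℤ` and `|E_z| < 4|f|`**:
`P_z(½+it) = −(¼ + t²)(4 Re f(½+it) + E_z)`, `f(½+it) = |f|e^{iθ_k(t)} = (−1)^j|f|`.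
[cite: Stark1967EpsteinZeros, §4] -/
theorem sign_epsteinP_critical (z : ℍ) (hy : 1 ≤ z.im) {t : ℝ} (ht : 0 < t) {j : ℕ}
    (hθ : starkTheta z.im t = j * π)
    (hE : ‖epsteinBesselPart z (1 / 2 + t * I)‖ < 4 * ‖starkF z (1 / 2 + t * I)‖) :
    (-1) ^ j * (epsteinP z (1 / 2 + t * I)).re < 0 := by
  set s : ℂ := 1 / 2 + t * I with hs
  have h0 : s ≠ 0 := fun h ↦ by have := congrArg Complex.re h; norm_num [hs] at this
  have h1 : s ≠ 1 := fun h ↦ by have := congrArg Complex.re h; norm_num [hs] at this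
  have hh : s ≠ 1 / 2 := fun h ↦ by have := congrArg Complex.im h; simp [hs] at this; exact ht.ne' this
  -- `f(s) = (−1)^j |f(s)|`
  have hf : starkF z s = (((-1) ^ j * ‖starkF z s‖ : ℝ) : ℂ) := by
    have h := starkF_critical_eq_norm_mul_exp z ht
    rw [hθ] at h
    have e : Complex.exp (((j * π : ℝ) : ℂ) * I) = (-1) ^ j := by
      rw [show ((j * π : ℝ) : ℂ) * I = (j : ℂ) * (π * I) by push_cast; ring, Complex.exp_nat_mul,
        Complex.exp_pi_mul_I]
    rw [← hs, e] at h
    conv_lhs => rw [h]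
    push_cast; ring
  -- `P(s) = s(s−1)(A + E)`, `A = 4 Re f(s)`
  have hA := two_mul_starkF_add_critical z t
  rw [← hs] at hA
  have hP : epsteinP z s = s * (s - 1) * ((2 * starkF z s + 2 * starkF z (1 - s)) + epsteinBesselPart z s) := by
    have := epsteinMain_eq z hy h0 h1 hh
    rw [epsteinMain_def] at this
    linear_combination this
  have hq : s * (s - 1) = ((-(1 / 4 + t ^ 2) : ℝ) : ℂ) := by
    rw [hs]; apply Complex.ext <;> simp [pow_two] <;> ring
  have hre : (starkF z s).re = (-1) ^ j * ‖starkF z s‖ := by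
    conv_lhs => rw [hf]
    rw [Complex.ofReal_re]
  rw [hP, hA, hq, hre, Complex.re_ofReal_mul, add_re, Complex.ofReal_re]
  have hsq : ((-1 : ℝ) ^ j) ^ 2 = 1 := by rw [← pow_mul, mul_comm, pow_mul]; simp
  have hEre : |(epsteinBesselPart z s).re| ≤ ‖epsteinBesselPart z s‖ := abs_re_le_norm _
  have hpos : 0 < 4 * ‖starkF z s‖ + (-1) ^ j * (epsteinBesselPart z s).re := by
    have h1' : |(-1 : ℝ) ^ j * (epsteinBesselPart z s).re| ≤ ‖epsteinBesselPart z s‖ := by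
      rw [abs_mul, abs_pow, abs_neg, abs_one, one_pow, one_mul]; exact hEre
    linarith [(abs_le.1 h1').1]
  have ht2 : 0 < 1 / 4 + t ^ 2 := by positivity
  have key : (-1) ^ j * (-(1 / 4 + t ^ 2) * (4 * ((-1) ^ j * ‖starkF z s‖) + (epsteinBesselPart z s).re)) =
      -(1 / 4 + t ^ 2) * (4 * ‖starkF z s‖ * ((-1 : ℝ) ^ j) ^ 2 + (-1) ^ j * (epsteinBesselPart z s).re) := by
    ring
  rw [key, hsq, mul_one]
  exact mul_neg_of_neg_of_pos (by linarith) hpos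

/-- **The `n` zeros on the critical segment (Stark §4).** If `θ_k(T₀) ≥ nπ` and
`|E_z(½+it)| < 4|f(½+it)|` for `0 < t ≤ T₀`, then `P_z(½ + iv) = 0` for `n` distinct
`v ∈ (0, T₀)` (`θ_k` starts negative just above `t = 0`). [cite: Stark1967EpsteinZeros, §4] -/
theorem exists_critical_zeros (z : ℍ) (hy : 1 ≤ z.im) {T₀ : ℝ} (hT : 1 / 4 ≤ T₀) {n : ℕ}
    (hθ : (n : ℝ) * π ≤ starkTheta z.im T₀)
    (hcrit : ∀ t : ℝ, 0 < t → t ≤ T₀ → ‖epsteinBesselPart z (1 / 2 + t * I)‖ < 4 * ‖starkF z (1 / 2 + t * I)‖) :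
    ∃ S : Finset ℝ, (↑S ⊆ Ioo (0 : ℝ) T₀) ∧ S.card = n ∧ ∀ v ∈ S, epsteinP z (1 / 2 + v * I) = 0 := by
  obtain ⟨t₀, ht₀, ht₀', hθ₀⟩ := exists_starkTheta_neg hy
  set g : ℝ → ℝ := fun t ↦ (epsteinP z (1 / 2 + t * I)).re with hg
  have hgc : Continuous g :=
    Complex.continuous_re.comp ((differentiable_epsteinP z).continuous.comp (by fun_prop))
  obtain ⟨S, hS, hcard, hzero⟩ := exists_finset_zeros_of_alternating (continuous_starkTheta z.im) hgc n t₀ T₀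
    (by linarith) hθ₀.le hθ (fun t ht j hj ↦ sign_epsteinP_critical z hy (ht₀.trans_le ht.1) hj
      (hcrit t (ht₀.trans_le ht.1) ht.2))
  refine ⟨S, fun v hv ↦ ⟨ht₀.trans (hS hv).1, (hS hv).2⟩, hcard, fun v hv ↦ ?_⟩
  apply Complex.ext
  · simpa [hg] using hzero v hv
  · simpa using epsteinP_half_add_im z v

/-! ## The Rouché inequalities from `|E_z| ≤ 48√k e^{−1.4πk}` -/

/-- **Right edge**: `|P_z − M_z| < |M_z|` on `2 + iy`, `0 ≤ y ≤ T₀ ≤ 2k + 50`, as soon as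
`48√k e^{−1.4πk} < k²e^{−π(k+25)}/250` (`|M_z| ≥ |s(s−1)||f(2+iy)| ≥ |s(s−1)|k²e^{−πy/2}/250`).
[cite: Stark1967EpsteinZeros, §3 Lemma 5 (proof)] -/
theorem epsteinDom_right (z : ℍ) (hk : 3 ≤ z.im) {T₀ : ℝ} (hT₀ : T₀ ≤ 2 * z.im + 50)
    (hL3 : 48 * Real.sqrt z.im * Real.exp (-(7 / 5) * π * z.im) <
      z.im ^ 2 * Real.exp (-(π * (z.im + 25))) / 250)
    {y : ℝ} (hy : y ∈ Icc (0 : ℝ) T₀) :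
    ‖epsteinP z (2 + y * I) - epsteinMain z (2 + y * I)‖ < ‖epsteinMain z (2 + y * I)‖ := by
  have hy1 : 1 ≤ z.im := by linarith
  have h0 : (2 : ℂ) + y * I ≠ 0 := fun h ↦ by have := congrArg Complex.re h; norm_num at this
  have h1 : (2 : ℂ) + y * I ≠ 1 := fun h ↦ by have := congrArg Complex.re h; norm_num at this
  have hh : (2 : ℂ) + y * I ≠ 1 / 2 := fun h ↦ by have := congrArg Complex.re h; norm_num at this
  rw [norm_epsteinP_sub_epsteinMain, epsteinMain_eq z hy1 h0 h1 hh, norm_mul (_ * _) (_ + _)]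
  refine mul_lt_mul_of_pos_left ?_ (norm_pos_iff.2 (mul_ne_zero h0 (sub_ne_zero.2 h1)))
  have hE := norm_epsteinBesselPart_le z hy1 (s := 2 + y * I) (by norm_num) (by norm_num)
  have hA := norm_starkF_le_norm_two_mul_add_right z (by linarith) y
  have hf := norm_starkF_two_add_ge z y
  have hexp : Real.exp (-(π * (z.im + 25))) ≤ Real.exp (-(π * |y|) / 2) := by
    rw [Real.exp_le_exp, abs_of_nonneg hy.1]; nlinarith [Real.pi_pos, hy.2]
  have hmono : z.im ^ 2 * Real.exp (-(π * (z.im + 25))) / 250 ≤ z.im ^ 2 * Real.exp (-(π * |y|) / 2) / 250 := by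
    gcongr
  calc ‖epsteinBesselPart z (2 + y * I)‖ ≤ 48 * Real.sqrt z.im * Real.exp (-(7 / 5) * π * z.im) := hE
    _ < z.im ^ 2 * Real.exp (-(π * (z.im + 25))) / 250 := hL3
    _ ≤ z.im ^ 2 * Real.exp (-(π * |y|) / 2) / 250 := hmono
    _ ≤ ‖starkF z (2 + y * I)‖ := hf
    _ ≤ _ := hA

/-- **Top edge**: `|P_z − M_z| < |M_z|` on `x + iT₀`, `½ ≤ x ≤ 2`, `2k ≤ T₀ ≤ 2k + 50`, `f(½+iT₀) > 0`,
as soon as `48√k e^{−1.4πk}` is below `2L₀` and `L₀²/(2D₀)`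
(`L₀ = c₀(4k+100)^{−7}(2/15)π^{−2}√k e^{−π(k+25)} ≤ |f|` on the edge, `D₀ = 11000k(4k+100)²e^{−πk} ≥ sup|f'|`):
near the corner `|2f(s)+2f(1−s)| ≥ 4|f(½+iT₀)| − 4D|x−½| ≥ 2L` for `x − ½ ≤ δ = L/(2D)`, and beyond
`|2f(s)+2f(1−s)| ≥ min((x−½)log k, 1)|f(s)| ≥ δL`. [cite: Stark1967EpsteinZeros, §3 Lemmas 4–5] -/
theorem epsteinDom_top {c₀ : ℝ} (hc0 : 0 < c₀) (hc0' : c₀ ≤ 1 / 4)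
    (hc₀ : ∀ w : ℂ, 1 ≤ w.re → w.re ≤ 4 → 4 ≤ |w.im| → c₀ / |w.im| ^ 7 ≤ ‖riemannZeta w‖)
    (z : ℍ) (hk : 3 ≤ z.im) {T₀ : ℝ} (h2k : 2 * z.im ≤ T₀) (hT₀ : T₀ ≤ 2 * z.im + 50)
    (hpos : starkF z (1 / 2 + T₀ * I) = ‖starkF z (1 / 2 + T₀ * I)‖)
    (hL4 : 48 * Real.sqrt z.im * Real.exp (-(7 / 5) * π * z.im) <
      2 * (c₀ / (4 * z.im + 100) ^ 7 * (2 / 15 * π ^ (-(2 : ℝ))) * Real.sqrt z.im * Real.exp (-(π * (z.im + 25)))))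
    (hL5 : 48 * Real.sqrt z.im * Real.exp (-(7 / 5) * π * z.im) <
      (c₀ / (4 * z.im + 100) ^ 7 * (2 / 15 * π ^ (-(2 : ℝ))) * Real.sqrt z.im * Real.exp (-(π * (z.im + 25)))) ^ 2 /
        (2 * (11000 * z.im * (4 * z.im + 100) ^ 2 * Real.exp (-(π * z.im)))))
    {x : ℝ} (hx : x ∈ Icc (1 / 2 : ℝ) 2) :
    ‖epsteinP z (x + T₀ * I) - epsteinMain z (x + T₀ * I)‖ < ‖epsteinMain z (x + T₀ * I)‖ := by
  have hy1 : 1 ≤ z.im := by linarith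
  have hkpos : 0 < z.im := z.im_pos
  have hT2 : 2 ≤ T₀ := by linarith
  have hT0 : 0 < T₀ := by linarith
  have hT1 : 1 ≤ T₀ := by linarith
  have hu0 : 0 < 4 * z.im + 100 := by linarith
  have h2T : 2 * T₀ ≤ 4 * z.im + 100 := by linarith
  have h2T' : 2 + T₀ ≤ 4 * z.im + 100 := by linarith
  have hπ := Real.pi_pos
  have hexp1 : Real.exp (-(π * (z.im + 25))) ≤ Real.exp (-(π * T₀) / 2) := by
    rw [Real.exp_le_exp]; nlinarith
  have hexp2 : Real.exp (-(π * T₀) / 2) ≤ Real.exp (-(π * z.im)) := by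
    rw [Real.exp_le_exp]; nlinarith
  have hlog : 1 ≤ Real.log z.im := by
    rw [Real.le_log_iff_exp_le hkpos]
    have := Real.exp_one_lt_d9
    linarith
  have hπ2 : π ^ (-(2 : ℝ)) ≤ 1 :=
    Real.rpow_le_one_of_one_le_of_nonpos (by linarith [Real.pi_gt_three]) (by norm_num)
  have hr1' : 1 ≤ Real.sqrt z.im := Real.one_le_sqrt.2 hy1
  have hrk' : Real.sqrt z.im ≤ z.im := by
    have := Real.sq_sqrt hkpos.le
    nlinarith
  -- the point and the `E` bound
  have h0 : (x : ℂ) + T₀ * I ≠ 0 := fun h ↦ by have := congrArg Complex.im h; simp at this; linarith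
  have h1 : (x : ℂ) + T₀ * I ≠ 1 := fun h ↦ by have := congrArg Complex.im h; simp at this; linarith
  have hh : (x : ℂ) + T₀ * I ≠ 1 / 2 := fun h ↦ by have := congrArg Complex.im h; simp at this; linarith
  have hE := norm_epsteinBesselPart_le z hy1 (s := x + T₀ * I) (by simp; linarith [hx.1]) (by simpa using hx.2)
  -- `A(½ + iT₀) = 4|f(½ + iT₀)|`
  have hAc_eq : 2 * starkF z (1 / 2 + T₀ * I) + 2 * starkF z (1 - (1 / 2 + T₀ * I)) =
      ((4 * ‖starkF z (1 / 2 + T₀ * I)‖ : ℝ) : ℂ) := by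
    rw [two_mul_starkF_add_critical]
    congr 2
    conv_lhs => rw [hpos]
    rw [Complex.ofReal_re]
  -- the atoms
  set C := 2 / 15 * π ^ (-(2 : ℝ)) with hC
  set r := Real.sqrt z.im with hr
  set e₂ := Real.exp (-(π * T₀) / 2) with he₂
  set L := c₀ / (2 * T₀) ^ 7 * C * r * e₂ with hL
  set L₀ := c₀ / (4 * z.im + 100) ^ 7 * C * r * Real.exp (-(π * (z.im + 25))) with hL₀
  set D := 11000 * z.im * (2 + T₀) ^ 2 * e₂ with hD
  set D₀ := 11000 * z.im * (4 * z.im + 100) ^ 2 * Real.exp (-(π * z.im)) with hD₀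
  have hC0 : 0 < C := by positivity
  have hC1 : C ≤ 1 := by
    rw [hC]
    have : (0 : ℝ) ≤ π ^ (-(2 : ℝ)) := by positivity
    linarith only [hπ2, this]
  have hr0 : 0 < r := Real.sqrt_pos.2 hkpos
  have he₂0 : 0 < e₂ := Real.exp_pos _
  have hL0 : 0 < L := by positivity
  have hL₀0 : 0 < L₀ := by positivity
  have hD0 : 0 < D := by positivity
  have hD₀0 : 0 < D₀ := by positivity
  -- `L₀ ≤ L`, `D ≤ D₀`
  have hL₀L : L₀ ≤ L := by
    have hdiv : c₀ / (4 * z.im + 100) ^ 7 ≤ c₀ / (2 * T₀) ^ 7 :=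
      div_le_div_of_nonneg_left hc0.le (by positivity) (pow_le_pow_left₀ (by positivity) h2T 7)
    rw [hL₀, hL]
    exact mul_le_mul (mul_le_mul_of_nonneg_right (mul_le_mul_of_nonneg_right hdiv hC0.le) hr0.le) hexp1
      (Real.exp_pos _).le (by positivity)
  have hDD₀ : D ≤ D₀ := by
    have hsq : (2 + T₀) ^ 2 ≤ (4 * z.im + 100) ^ 2 := pow_le_pow_left₀ (by positivity) h2T' 2
    rw [hD, hD₀]
    exact mul_le_mul (mul_le_mul_of_nonneg_left hsq (by positivity)) hexp2 he₂0.le (by positivity)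
  -- `δ`
  set δ := L / (2 * D) with hδ
  have hδ0 : 0 < δ := by positivity
  have hL' : L ≤ 1 / 4 * 1 * z.im * e₂ := by
    have h1 : c₀ / (2 * T₀) ^ 7 ≤ 1 / 4 :=
      (div_le_self hc0.le (one_le_pow₀ (by linarith only [hT1]))).trans hc0'
    rw [hL]
    exact mul_le_mul_of_nonneg_right (mul_le_mul (mul_le_mul h1 hC1 hC0.le (by norm_num)) hrk' hr0.le
      (by norm_num)) he₂0.le
  have hD' : z.im * e₂ ≤ D := by
    rw [hD]
    have h11 : (1 : ℝ) ≤ 11000 * (2 + T₀) ^ 2 := by nlinarith only [hT2]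
    have h' := mul_le_mul_of_nonneg_right h11 (by positivity : 0 ≤ z.im * e₂)
    have e : 11000 * (2 + T₀) ^ 2 * (z.im * e₂) = 11000 * z.im * (2 + T₀) ^ 2 * e₂ := by ring
    linarith only [h', e]
  have hδ8 : δ ≤ 1 / 8 := by
    rw [hδ, div_le_iff₀ (by positivity)]
    linarith only [hL', hD']
  have h4Dδ : 4 * D * δ = 2 * L := by
    rw [hδ, show 4 * D * (L / (2 * D)) = 2 * L * (D / D) by ring, div_self hD0.ne', mul_one]
  have hδL : δ * L = L ^ 2 / (2 * D) := by rw [hδ, sq]; ring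
  -- `|f| ≥ L` on the edge
  have hfL : ∀ x' ∈ Icc (1 / 2 : ℝ) 2, L ≤ ‖starkF z (x' + T₀ * I)‖ := by
    intro x' hx'
    have hre' : ((x' : ℂ) + T₀ * I).re = x' := by simp
    have him' : ((x' : ℂ) + T₀ * I).im = T₀ := by simp
    have := norm_starkF_ge_of_half_le hc0 hc₀ z hy1 (s := x' + T₀ * I) (by rw [hre']; exact hx'.1)
      (by rw [hre']; exact hx'.2) (by rw [him', abs_of_pos hT0]; exact hT2)
    rw [him', abs_of_pos hT0] at this
    exact this
  -- the mean-value estimate near the corner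
  have hsub_gen : ∀ σ : ℝ, |σ - 1 / 2| ≤ 1 / 8 →
      ‖(2 * starkF z (σ + T₀ * I) + 2 * starkF z (1 - (σ + T₀ * I))) -
        (2 * starkF z (1 / 2 + T₀ * I) + 2 * starkF z (1 - (1 / 2 + T₀ * I)))‖ ≤ 4 * D * |σ - 1 / 2| :=
    fun σ hσ ↦ norm_starkA_sub_le z hy1 hT2 hσ le_rfl
  have hfc : L ≤ ‖starkF z (1 / 2 + T₀ * I)‖ := by
    have := hfL (1 / 2) ⟨le_rfl, by norm_num⟩
    simpa using this
  have hfs : L ≤ ‖starkF z (x + T₀ * I)‖ := hfL x hx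
  clear_value δ D₀ D L₀ L e₂ r C
  -- reduce to `|E| < |A|`
  rw [norm_epsteinP_sub_epsteinMain, epsteinMain_eq z hy1 h0 h1 hh, norm_mul (_ * _) (_ + _)]
  refine mul_lt_mul_of_pos_left ?_ (norm_pos_iff.2 (mul_ne_zero h0 (sub_ne_zero.2 h1)))
  rcases le_or_gt x (1 / 2 + δ) with hnear | hfar
  · -- near the corner
    have habs : |x - 1 / 2| ≤ δ := by rw [abs_of_nonneg (by linarith [hx.1])]; linarith
    have hsub := hsub_gen x (habs.trans hδ8)
    have hAc_norm : ‖(2 * starkF z (1 / 2 + T₀ * I) + 2 * starkF z (1 - (1 / 2 + T₀ * I)))‖ =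
        4 * ‖starkF z (1 / 2 + T₀ * I)‖ := by
      rw [hAc_eq, Complex.norm_real, Real.norm_of_nonneg (by positivity)]
    have n1 := norm_sub_norm_le (2 * starkF z (1 / 2 + T₀ * I) + 2 * starkF z (1 - (1 / 2 + T₀ * I)))
      (2 * starkF z (x + T₀ * I) + 2 * starkF z (1 - (x + T₀ * I)))
    rw [norm_sub_rev] at n1
    have n2 : 4 * D * |x - 1 / 2| ≤ 4 * D * δ := mul_le_mul_of_nonneg_left habs (by positivity)
    linarith
  · -- away from the corner
    have hre_x : ((x : ℂ) + T₀ * I).re = x := by simp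
    have him_x : ((x : ℂ) + T₀ * I).im = T₀ := by simp
    have hmin := norm_two_mul_starkF_add_ge z hk (s := x + T₀ * I) (by rw [hre_x]; linarith)
      (by rw [hre_x]; exact hx.2) (by rw [him_x, abs_of_pos hT0]; exact hT1)
    rw [hre_x] at hmin
    have hδmin' : δ ≤ (x - 1 / 2) * Real.log z.im := by
      calc δ = δ * 1 := (mul_one δ).symm
        _ ≤ (x - 1 / 2) * Real.log z.im := mul_le_mul (by linarith) hlog zero_le_one (by linarith)
    have hδmin : δ ≤ min ((x - 1 / 2) * Real.log z.im) 1 := le_min hδmin' (by linarith)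
    have hmin0 : 0 ≤ min ((x - 1 / 2) * Real.log z.im) 1 :=
      le_min (mul_nonneg (by linarith) (by linarith)) (by norm_num)
    have hcmp : L₀ ^ 2 / (2 * D₀) ≤ L ^ 2 / (2 * D) :=
      div_le_div₀ (sq_nonneg _) (pow_le_pow_left₀ hL₀0.le hL₀L 2) (mul_pos two_pos hD0) (by linarith)
    calc ‖epsteinBesselPart z (x + T₀ * I)‖ ≤ 48 * r * Real.exp (-(7 / 5) * π * z.im) := hE
      _ < L₀ ^ 2 / (2 * D₀) := hL5
      _ ≤ L ^ 2 / (2 * D) := hcmp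
      _ = δ * L := hδL.symm
      _ ≤ min ((x - 1 / 2) * Real.log z.im) 1 * ‖starkF z (x + T₀ * I)‖ := mul_le_mul hδmin hfs hL0.le hmin0
      _ ≤ _ := hmin

/-- **Critical segment**: `|E_z(½ + it)| < 4|f(½ + it)|` for `0 < t ≤ T₀ ≤ 2k + 50` as soon as
`48√k e^{−1.4πk}` is below `2L₀` and `4c₂(2/15)π^{−1/2}√k e^{−π}`. [cite: Stark1967EpsteinZeros, §4] -/
theorem epsteinCrit_dom {c₀ c₂ : ℝ} (hc0 : 0 < c₀)
    (hc₀ : ∀ w : ℂ, 1 ≤ w.re → w.re ≤ 4 → 4 ≤ |w.im| → c₀ / |w.im| ^ 7 ≤ ‖riemannZeta w‖)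
    (hc2 : 0 < c₂) (hc₂ : ∀ u : ℝ, 0 < u → u ≤ 4 → c₂ ≤ ‖riemannZeta (1 + u * I)‖)
    (z : ℍ) (hk : 3 ≤ z.im) {T₀ : ℝ} (hT₀ : T₀ ≤ 2 * z.im + 50)
    (hL4 : 48 * Real.sqrt z.im * Real.exp (-(7 / 5) * π * z.im) <
      2 * (c₀ / (4 * z.im + 100) ^ 7 * (2 / 15 * π ^ (-(2 : ℝ))) * Real.sqrt z.im * Real.exp (-(π * (z.im + 25)))))
    (hL6 : 48 * Real.sqrt z.im * Real.exp (-(7 / 5) * π * z.im) <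
      4 * (c₂ * (2 / 15 * π ^ (-(1 / 2 : ℝ))) * Real.sqrt z.im * Real.exp (-π)))
    {t : ℝ} (ht : 0 < t) (htT : t ≤ T₀) :
    ‖epsteinBesselPart z (1 / 2 + t * I)‖ < 4 * ‖starkF z (1 / 2 + t * I)‖ := by
  have hy1 : 1 ≤ z.im := by linarith
  have hE := norm_epsteinBesselPart_le z hy1 (s := 1 / 2 + t * I) (by norm_num) (by norm_num)
  refine hE.trans_lt ?_
  rcases le_or_gt t 2 with h2 | h2
  · have hsmall := norm_starkF_half_ge_small hc2 hc₂ z ht h2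
    have hexp : Real.exp (-π) ≤ Real.exp (-(π * t) / 2) := by
      rw [Real.exp_le_exp]; nlinarith [Real.pi_pos]
    calc 48 * Real.sqrt z.im * Real.exp (-(7 / 5) * π * z.im)
        < 4 * (c₂ * (2 / 15 * π ^ (-(1 / 2 : ℝ))) * Real.sqrt z.im * Real.exp (-π)) := hL6
      _ ≤ 4 * (c₂ * (2 / 15 * π ^ (-(1 / 2 : ℝ))) * Real.sqrt z.im * Real.exp (-(π * t) / 2)) := by gcongr
      _ ≤ 4 * ‖starkF z (1 / 2 + t * I)‖ := by linarith
  · have him : ((1 / 2 : ℂ) + t * I).im = t := by simp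
    have hbig := norm_starkF_ge_of_half_le hc0 hc₀ z hy1 (s := 1 / 2 + t * I) (by norm_num) (by norm_num)
      (by rw [him, abs_of_pos ht]; linarith)
    rw [him, abs_of_pos ht] at hbig
    have hdiv : c₀ / (4 * z.im + 100) ^ 7 ≤ c₀ / (2 * t) ^ 7 :=
      div_le_div_of_nonneg_left hc0.le (by positivity) (pow_le_pow_left₀ (by linarith) (by linarith) 7)
    have hexp : Real.exp (-(π * (z.im + 25))) ≤ Real.exp (-(π * t) / 2) := by
      rw [Real.exp_le_exp]; nlinarith [Real.pi_pos]
    have hL₀ : c₀ / (4 * z.im + 100) ^ 7 * (2 / 15 * π ^ (-(2 : ℝ))) * Real.sqrt z.im * Real.exp (-(π * (z.im + 25))) ≤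
        c₀ / (2 * t) ^ 7 * (2 / 15 * π ^ (-(2 : ℝ))) * Real.sqrt z.im * Real.exp (-(π * t) / 2) :=
      mul_le_mul (mul_le_mul_of_nonneg_right (mul_le_mul_of_nonneg_right hdiv (by positivity)) (Real.sqrt_nonneg _))
        hexp (Real.exp_pos _).le (by positivity)
    have hpos : 0 ≤ c₀ / (2 * t) ^ 7 * (2 / 15 * π ^ (-(2 : ℝ))) * Real.sqrt z.im * Real.exp (-(π * t) / 2) := by
      positivity
    linarith

/-! ## Largeness of `k` -/

/-- The hypothesis of `exists_starkT₀` for `k ≥ 26` with `6 log k ≥ 160 + 5.5π + 44 log 960`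
(`log(7/6) ≥ 1/7`, `14π ≤ 44`, `log(480k + 12480) ≤ log 960 + log k`). [folklore] -/
theorem stark_hlarge {k : ℝ} (hk : 26 ≤ k) (hlog : 160 + 11 / 2 * π + 44 * Real.log 960 ≤ 6 * Real.log k) :
    2 * π + π / 2 + (3 * π + 2 * π * (Real.log (120 * (2 * (2 * k + 50) + 4)) / Real.log (7 / 6))) ≤
      50 * (Real.log k - 16 / 5) := by
  have hl76 : 1 / 7 ≤ Real.log (7 / 6) := by
    have := Real.one_sub_inv_le_log_of_pos (by norm_num : (0 : ℝ) < 7 / 6)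
    norm_num at this
    linarith
  have hl76pos : 0 < Real.log (7 / 6) := by linarith
  have hlogk : 0 ≤ Real.log k := Real.log_nonneg (by linarith)
  have hlog960 : 0 ≤ Real.log 960 := Real.log_nonneg (by norm_num)
  have harg : Real.log (120 * (2 * (2 * k + 50) + 4)) ≤ Real.log 960 + Real.log k := by
    rw [← Real.log_mul (by norm_num) (by linarith)]
    exact Real.log_le_log (by positivity) (by nlinarith)
  have h1 : Real.log (120 * (2 * (2 * k + 50) + 4)) / Real.log (7 / 6) ≤ 7 * (Real.log 960 + Real.log k) := by
    rw [div_le_iff₀ hl76pos]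
    nlinarith
  have hπ4 := Real.pi_lt_d4
  have hπ0 := Real.pi_pos
  have h2 : 2 * π * (Real.log (120 * (2 * (2 * k + 50) + 4)) / Real.log (7 / 6)) ≤ 44 * (Real.log 960 + Real.log k) := by
    have := mul_le_mul_of_nonneg_left h1 (by positivity : (0 : ℝ) ≤ 2 * π)
    nlinarith
  linarith

/-- From `48 · 8¹⁷ k¹⁷ e^{−(2/5)πk} < η` (`k ≥ 26`) to the four inequalities `48√k e^{−1.4πk} < …` used on the
right edge, the top edge (two) and the critical segment. [folklore] -/
theorem stark_ineqs {c₀ c₂ : ℝ} (hc0 : 0 < c₀) {k : ℝ} (hk : 26 ≤ k)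
    (hG : 48 * 8 ^ 17 * (k ^ (17 : ℝ) * Real.exp (-(2 / 5 * π) * k)) <
      min (min (Real.exp (-(25 * π)) / 250) (2 * c₀ * (2 / 15 * π ^ (-(2 : ℝ))) * Real.exp (-(25 * π))))
        (min (c₀ ^ 2 * (2 / 15 * π ^ (-(2 : ℝ))) ^ 2 * Real.exp (-(25 * π)) ^ 2 / 22000)
          (4 * (c₂ * (2 / 15 * π ^ (-(1 / 2 : ℝ)))) * Real.exp (-π)))) :
    (48 * Real.sqrt k * Real.exp (-(7 / 5) * π * k) < k ^ 2 * Real.exp (-(π * (k + 25))) / 250) ∧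
    (48 * Real.sqrt k * Real.exp (-(7 / 5) * π * k) <
      2 * (c₀ / (4 * k + 100) ^ 7 * (2 / 15 * π ^ (-(2 : ℝ))) * Real.sqrt k * Real.exp (-(π * (k + 25))))) ∧
    (48 * Real.sqrt k * Real.exp (-(7 / 5) * π * k) <
      (c₀ / (4 * k + 100) ^ 7 * (2 / 15 * π ^ (-(2 : ℝ))) * Real.sqrt k * Real.exp (-(π * (k + 25)))) ^ 2 /
        (2 * (11000 * k * (4 * k + 100) ^ 2 * Real.exp (-(π * k))))) ∧
    (48 * Real.sqrt k * Real.exp (-(7 / 5) * π * k) <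
      4 * (c₂ * (2 / 15 * π ^ (-(1 / 2 : ℝ))) * Real.sqrt k * Real.exp (-π))) := by
  set C := 2 / 15 * π ^ (-(2 : ℝ)) with hC
  set C' := 2 / 15 * π ^ (-(1 / 2 : ℝ)) with hC'
  set r := Real.sqrt k with hr
  set u := 4 * k + 100 with hu
  set q := Real.exp (-(2 / 5 * π) * k) with hq
  set eπ := Real.exp (-(π * k)) with heπ
  set E25 := Real.exp (-(25 * π)) with hE25
  set B := (8 : ℝ) ^ 17 * k ^ 17 with hB
  have hC0 : 0 < C := by positivity
  have hC'0 : 0 < C' := by positivity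
  have hk0 : 0 < k := by linarith
  have hk1 : 1 ≤ k := by linarith
  have hr0 : 0 < r := Real.sqrt_pos.2 hk0
  have hr1 : 1 ≤ r := by rw [hr]; exact Real.one_le_sqrt.2 hk1
  have hrk : r ≤ k := by nlinarith [Real.sq_sqrt hk0.le]
  have hr2 : r ^ 2 = k := Real.sq_sqrt hk0.le
  have hu0 : 0 < u := by rw [hu]; linarith
  have hu1 : 1 ≤ u := by rw [hu]; linarith
  have hku : k ≤ u := by rw [hu]; linarith
  have hu8 : u ≤ 8 * k := by rw [hu]; linarith
  have hq0 : 0 < q := Real.exp_pos _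
  have heπ0 : 0 < eπ := Real.exp_pos _
  have hE250 : 0 < E25 := Real.exp_pos _
  have hε : 48 * r * Real.exp (-(7 / 5) * π * k) = 48 * r * q * eπ := by
    rw [show -(7 / 5) * π * k = -(2 / 5 * π) * k + -(π * k) by ring, Real.exp_add]; ring
  have he₁ : Real.exp (-(π * (k + 25))) = eπ * E25 := by
    rw [show -(π * (k + 25)) = -(π * k) + -(25 * π) by ring, Real.exp_add]
  -- `48 q B < η`
  have hk17 : k ^ (17 : ℝ) = k ^ 17 := by exact_mod_cast Real.rpow_natCast k 17
  rw [hk17] at hG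
  have hGB : 48 * q * B < min (min (E25 / 250) (2 * c₀ * C * E25)) (min (c₀ ^ 2 * C ^ 2 * E25 ^ 2 / 22000)
      (4 * (c₂ * C') * Real.exp (-π))) := by
    have e : 48 * q * B = 48 * 8 ^ 17 * (k ^ 17 * q) := by rw [hB]; ring
    rw [e]; exact hG
  have g1 : 48 * q * B < E25 / 250 := lt_of_lt_of_le hGB ((min_le_left _ _).trans (min_le_left _ _))
  have g2 : 48 * q * B < 2 * c₀ * C * E25 := lt_of_lt_of_le hGB ((min_le_left _ _).trans (min_le_right _ _))
  have g3 : 48 * q * B < c₀ ^ 2 * C ^ 2 * E25 ^ 2 / 22000 :=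
    lt_of_lt_of_le hGB ((min_le_right _ _).trans (min_le_left _ _))
  have g4 : 48 * q * B < 4 * (c₂ * C') * Real.exp (-π) :=
    lt_of_lt_of_le hGB ((min_le_right _ _).trans (min_le_right _ _))
  -- bounds by `B`
  have hB1 : 1 ≤ B := by
    rw [hB]; exact one_le_mul_of_one_le_of_one_le (by norm_num) (one_le_pow₀ hk1)
  have huB : u ^ 17 ≤ B := by rw [hB, ← mul_pow]; exact pow_le_pow_left₀ hu0.le hu8 17
  have hu7 : u ^ 7 ≤ B := (pow_le_pow_right₀ hu1 (by norm_num : 7 ≤ 17)).trans huB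
  have hrB : r ≤ B := by
    calc r ≤ u := hrk.trans hku
      _ = u ^ 1 := (pow_one u).symm
      _ ≤ u ^ 17 := pow_le_pow_right₀ hu1 (by norm_num)
      _ ≤ B := huB
  have hru16 : r * u ^ 16 ≤ B := by
    calc r * u ^ 16 ≤ u * u ^ 16 := mul_le_mul_of_nonneg_right (hrk.trans hku) (by positivity)
      _ = u ^ 17 := by ring
      _ ≤ B := huB
  refine ⟨?_, ?_, ?_, ?_⟩
  · rw [hε, he₁]
    have hk2 : 1 ≤ k ^ 2 := one_le_pow₀ hk1
    calc 48 * r * q * eπ = 48 * q * r * eπ := by ring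
      _ ≤ 48 * q * B * eπ := by gcongr
      _ < E25 / 250 * eπ := mul_lt_mul_of_pos_right g1 heπ0
      _ = 1 * (eπ * E25) / 250 := by ring
      _ ≤ k ^ 2 * (eπ * E25) / 250 := by gcongr
  · rw [hε, he₁]
    have e : 2 * (c₀ / u ^ 7 * C * r * (eπ * E25)) = (2 * c₀ * C * E25 / u ^ 7) * (r * eπ) := by ring
    rw [e, show 48 * r * q * eπ = (48 * q) * (r * eπ) by ring]
    refine mul_lt_mul_of_pos_right ?_ (by positivity)
    rw [lt_div_iff₀ (by positivity)]
    calc 48 * q * u ^ 7 ≤ 48 * q * B := by gcongr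
      _ < 2 * c₀ * C * E25 := g2
  · rw [hε, he₁]
    have hune : u ≠ 0 := hu0.ne'
    have hkne : k ≠ 0 := hk0.ne'
    have heπne : eπ ≠ 0 := heπ0.ne'
    have e : (c₀ / u ^ 7 * C * r * (eπ * E25)) ^ 2 / (2 * (11000 * k * u ^ 2 * eπ)) =
        (c₀ ^ 2 * C ^ 2 * E25 ^ 2 / 22000 / u ^ 16) * eπ := by
      rw [show (c₀ / u ^ 7 * C * r * (eπ * E25)) ^ 2 = c₀ ^ 2 * C ^ 2 * r ^ 2 * eπ ^ 2 * E25 ^ 2 / u ^ 14 by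
        field_simp, hr2]
      field_simp
      ring
    rw [e, show 48 * r * q * eπ = (48 * r * q) * eπ by ring]
    refine mul_lt_mul_of_pos_right ?_ heπ0
    rw [lt_div_iff₀ (by positivity)]
    calc 48 * r * q * u ^ 16 = 48 * q * (r * u ^ 16) := by ring
      _ ≤ 48 * q * B := by gcongr
      _ < c₀ ^ 2 * C ^ 2 * E25 ^ 2 / 22000 := g3
  · have hexp : Real.exp (-(7 / 5) * π * k) ≤ q := by
      rw [hq, Real.exp_le_exp]; nlinarith [Real.pi_pos]
    have e : 4 * (c₂ * C' * r * Real.exp (-π)) = (4 * (c₂ * C') * Real.exp (-π)) * r := by ring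
    rw [e, show 48 * r * Real.exp (-(7 / 5) * π * k) = (48 * Real.exp (-(7 / 5) * π * k)) * r by ring]
    refine mul_lt_mul_of_pos_right ?_ hr0
    calc 48 * Real.exp (-(7 / 5) * π * k) ≤ 48 * q := by gcongr
      _ ≤ 48 * q * B := le_mul_of_one_le_right (by positivity) hB1
      _ < _ := g4

/-! ## Assembly: Stark's Theorem 1 for one form with `k` large -/
set_option maxHeartbeats 400000 in -- buildfix (bf3-g26): 160k/180k FAIL, 200k PASS at accept time; line-neutral budget line
/-- **Stark's Theorem 1 for a form whose `k` satisfies the largeness conditions** (all zeros of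
any continuation `Z` of `ζ_Q` in `−1 < σ < 2`, `|t| ≤ 2k`, `s ≠ 1`, are simple, and lie on `σ = ½`
except for the Bateman–Grosswald pair `β₁ = 1 − β₂ < ½ < β₂`). [cite: Stark1967EpsteinZeros, Theorem 1, §4] -/
theorem stark_main {c₀ c₂ : ℝ} (hc0 : 0 < c₀) (hc0' : c₀ ≤ 1 / 4)
    (hc₀ : ∀ w : ℂ, 1 ≤ w.re → w.re ≤ 4 → 4 ≤ |w.im| → c₀ / |w.im| ^ 7 ≤ ‖riemannZeta w‖)
    (hc2 : 0 < c₂) (hc₂ : ∀ u : ℝ, 0 < u → u ≤ 4 → c₂ ≤ ‖riemannZeta (1 + u * I)‖)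
    {a b c : ℝ} (hQ : IsPosDefForm a b c) (z : ℍ) (hre : z.re = b / (2 * a))
    (him : z.im = Real.sqrt (4 * c * a - b ^ 2) / (2 * a)) (hkK : z.im = starkK a b c)
    (h26 : 26 ≤ z.im) (hlog : 160 + 11 / 2 * π + 44 * Real.log 960 ≤ 6 * Real.log z.im)
    (hL3 : 48 * Real.sqrt z.im * Real.exp (-(7 / 5) * π * z.im) <
      z.im ^ 2 * Real.exp (-(π * (z.im + 25))) / 250)
    (hL4 : 48 * Real.sqrt z.im * Real.exp (-(7 / 5) * π * z.im) <
      2 * (c₀ / (4 * z.im + 100) ^ 7 * (2 / 15 * π ^ (-(2 : ℝ))) * Real.sqrt z.im * Real.exp (-(π * (z.im + 25)))))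
    (hL5 : 48 * Real.sqrt z.im * Real.exp (-(7 / 5) * π * z.im) <
      (c₀ / (4 * z.im + 100) ^ 7 * (2 / 15 * π ^ (-(2 : ℝ))) * Real.sqrt z.im * Real.exp (-(π * (z.im + 25)))) ^ 2 /
        (2 * (11000 * z.im * (4 * z.im + 100) ^ 2 * Real.exp (-(π * z.im)))))
    (hL6 : 48 * Real.sqrt z.im * Real.exp (-(7 / 5) * π * z.im) <
      4 * (c₂ * (2 / 15 * π ^ (-(1 / 2 : ℝ))) * Real.sqrt z.im * Real.exp (-π)))
    {Z : ℂ → ℂ} (hZ : IsEpsteinContinuation a b c Z) :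
    (∀ s ∈ starkBox (starkK a b c), s ≠ 1 → Z s = 0 → deriv Z s ≠ 0) ∧
      ∃ β₁ β₂ : ℝ, 0 < β₁ ∧ β₁ < 1 / 2 ∧ 1 / 2 < β₂ ∧ β₂ < 1 ∧ β₁ + β₂ = 1 ∧
        Z β₁ = 0 ∧ Z β₂ = 0 ∧
        ∀ s ∈ starkBox (starkK a b c), s ≠ 1 → Z s = 0 → s.re = 1 / 2 ∨ s = (β₁ : ℂ) ∨ s = (β₂ : ℂ) := by
  have hk3 : 3 ≤ z.im := by linarith
  have hk1 : 1 ≤ z.im := by linarith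
  -- the height `T₀`
  obtain ⟨T₀, ⟨h2k, hT50⟩, m, hθ⟩ := exists_starkT₀ hk1 (stark_hlarge h26 hlog)
  have hT2 : 2 ≤ T₀ := by linarith
  have hT0 : 0 < T₀ := by linarith
  have hpos := starkF_corner_pos z hT0 hθ
  -- Rouché hypotheses and the critical segment
  have hEr : ∀ y ∈ Icc (0 : ℝ) T₀,
      ‖epsteinP z (2 + y * I) - epsteinMain z (2 + y * I)‖ < ‖epsteinMain z (2 + y * I)‖ :=
    fun y hy ↦ epsteinDom_right z hk3 hT50 hL3 hy
  have hEt : ∀ x ∈ Icc (1 / 2 : ℝ) 2,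
      ‖epsteinP z (x + T₀ * I) - epsteinMain z (x + T₀ * I)‖ < ‖epsteinMain z (x + T₀ * I)‖ :=
    fun x hx ↦ epsteinDom_top hc0 hc0' hc₀ z hk3 h2k hT50 hpos hL4 hL5 hx
  have hcrit : ∀ t : ℝ, 0 < t → t ≤ T₀ →
      ‖epsteinBesselPart z (1 / 2 + t * I)‖ < 4 * ‖starkF z (1 / 2 + t * I)‖ :=
    fun t ht htT ↦ epsteinCrit_dom hc0 hc₀ hc2 hc₂ z hk3 hT50 hL4 hL6 ht htT
  -- the count `4m + 2`
  have hsum := finsum_order_epsteinP_eq z hk3 hT2 hθ hEr hEt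
  obtain ⟨hPb, hPt, -, -⟩ := epsteinP_ne_zero_boundary z hEr hEt
  have hPan : AnalyticOnNhd ℂ (epsteinP z) (Icc (-1 : ℝ) 2 ×ℂ Icc (-T₀) T₀) := fun s _ ↦
    (differentiable_epsteinP z).analyticAt s
  have h0mem : (0 : ℂ) ∈ Icc (-1 : ℝ) 2 ×ℂ Icc (-T₀) T₀ :=
    ⟨⟨by simp, by simp⟩, ⟨by simp; linarith, by simp; linarith⟩⟩
  have hP0 : epsteinP z 0 ≠ 0 := by rw [epsteinP_zero]; exact one_ne_zero
  have hfin := finite_zeros_reProdIm (f := epsteinP z) (a := -1) (b := 2) (c := -T₀) (d := T₀)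
    (by norm_num) (by linarith) hPan h0mem hP0
  rw [finsum_mem_eq_finite_toFinset_sum _ hfin] at hsum
  set Zf := hfin.toFinset with hZf
  have hmemZf : ∀ ρ, ρ ∈ Zf ↔ epsteinP z ρ = 0 ∧ ρ ∈ Ioo (-1 : ℝ) 2 ×ℂ Ioo (-T₀) T₀ := fun ρ ↦ by
    rw [hZf, Set.Finite.mem_toFinset]; rfl
  -- multiplicities are `≥ 1`, and `= 1` means a simple zero
  have hord : ∀ ρ ∈ Zf, 1 ≤ (meromorphicOrderAt (epsteinP z) ρ).untop₀ ∧
      ((meromorphicOrderAt (epsteinP z) ρ).untop₀ = 1 → deriv (epsteinP z) ρ ≠ 0) := by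
    intro ρ hρ
    obtain ⟨hPρ, hρR⟩ := (hmemZf ρ).1 hρ
    have hρK : ρ ∈ Icc (-1 : ℝ) 2 ×ℂ Icc (-T₀) T₀ := ⟨Ioo_subset_Icc_self hρR.1, Ioo_subset_Icc_self hρR.2⟩
    have han : AnalyticAt ℂ (epsteinP z) ρ := hPan ρ hρK
    have hne := analyticOrderAt_ne_top_of_reProdIm (by norm_num) (by linarith) hPan h0mem hP0 hρK
    rw [han.meromorphicOrderAt_eq]
    cases h : analyticOrderAt (epsteinP z) ρ with
    | top => exact absurd h hne
    | coe n =>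
      have hn : n ≠ 0 := by
        intro hn0
        rw [hn0] at h
        exact (han.analyticOrderAt_eq_zero.mp (by exact_mod_cast h)) hPρ
      have e : ((n : ℕ∞).map (Nat.cast : ℕ → ℤ)).untop₀ = (n : ℤ) := by simp
      rw [e]
      refine ⟨by omega, fun h1 ↦ deriv_ne_zero_of_analyticOrderAt_eq_one han ?_⟩
      rw [h]
      have : n = 1 := by exact_mod_cast h1
      rw [this]; rfl
  have hsumZ : ∑ ρ ∈ Zf, (meromorphicOrderAt (epsteinP z) ρ).untop₀ = 4 * m + 2 := by
    have h : ((∑ ρ ∈ Zf, (meromorphicOrderAt (epsteinP z) ρ).untop₀ : ℤ) : ℂ) = ((4 * m + 2 : ℤ) : ℂ) := by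
      push_cast; exact hsum
    exact_mod_cast h
  have hcard_le_sum : (Zf.card : ℤ) ≤ ∑ ρ ∈ Zf, (meromorphicOrderAt (epsteinP z) ρ).untop₀ := by
    have := Finset.card_nsmul_le_sum Zf (fun ρ ↦ (meromorphicOrderAt (epsteinP z) ρ).untop₀) 1
      (fun ρ hρ ↦ (hord ρ hρ).1)
    simpa using this
  have hm0 : 0 ≤ m := by
    have : (0 : ℤ) ≤ Zf.card := Nat.cast_nonneg _
    omega
  -- the Bateman–Grosswald pair
  obtain ⟨β₂, hβ₂, hβ₂', hZβ₂⟩ := BatemanGrosswald1964_realZero_holds a b c hQ (by rw [← hkK]; linarith) Z hZ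
  have hβ₂1 : (β₂ : ℂ) ≠ 1 := fun h ↦ by
    have := congrArg Complex.re h; simp at this; linarith
  have hPβ₂ : epsteinP z β₂ = 0 :=
    (continuation_eq_zero_iff hQ z hre him hZ (s := β₂) (by simp; linarith) hβ₂1).1 hZβ₂
  have hPβ₁ : epsteinP z ((1 - β₂ : ℝ) : ℂ) = 0 := by
    rw [show ((1 - β₂ : ℝ) : ℂ) = 1 - (β₂ : ℂ) by push_cast; ring, epsteinP_one_sub]; exact hPβ₂
  -- the `2m` zeros on the critical segment
  have hn : (((2 * m).toNat : ℕ) : ℝ) = 2 * m := by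
    have : (((2 * m).toNat : ℕ) : ℤ) = 2 * m := Int.toNat_of_nonneg (by omega)
    exact_mod_cast this
  obtain ⟨Sc, hSc, hSccard, hScz⟩ := exists_critical_zeros z hk1 (T₀ := T₀) (by linarith) (n := (2 * m).toNat)
    (by rw [hn, hθ]; linarith [Real.pi_pos]) hcrit
  -- the `4m + 2` known zeros
  set Sp : Finset ℂ := Sc.image (fun v : ℝ ↦ (1 / 2 : ℂ) + v * I) with hSp
  set Sm : Finset ℂ := Sc.image (fun v : ℝ ↦ (1 / 2 : ℂ) - v * I) with hSm
  set S : Finset ℂ := ({((1 - β₂ : ℝ) : ℂ), (β₂ : ℂ)} ∪ Sp) ∪ Sm with hS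
  have hSsub : S ⊆ Zf := by
    intro ρ hρ
    rw [hmemZf]
    simp only [hS, hSp, hSm, Finset.mem_union, Finset.mem_insert, Finset.mem_singleton, Finset.mem_image] at hρ
    rcases hρ with ((rfl | rfl) | ⟨v, hv, rfl⟩) | ⟨v, hv, rfl⟩
    · refine ⟨hPβ₁, ⟨?_, ?_⟩, ?_, ?_⟩ <;> simp <;> linarith
    · refine ⟨hPβ₂, ⟨?_, ?_⟩, ?_, ?_⟩ <;> simp <;> linarith
    · have hv' := hSc hv
      refine ⟨hScz v hv, ⟨?_, ?_⟩, ?_, ?_⟩ <;> simp <;> linarith [hv'.1, hv'.2]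
    · have hv' := hSc hv
      refine ⟨?_, ⟨?_, ?_⟩, ?_, ?_⟩
      · have e : (1 / 2 : ℂ) - v * I = conj (1 / 2 + v * I) := by
          apply Complex.ext <;> simp
        rw [e, epsteinP_conj, hScz v hv, map_zero]
      all_goals (simp; try linarith [hv'.1, hv'.2])
  have hinj1 : Function.Injective (fun v : ℝ ↦ (1 / 2 : ℂ) + v * I) := fun v w h ↦ by
    simpa using congrArg Complex.im h
  have hinj2 : Function.Injective (fun v : ℝ ↦ (1 / 2 : ℂ) - v * I) := fun v w h ↦ by
    simpa using congrArg Complex.im h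
  have hcard : (S.card : ℤ) = 4 * m + 2 := by
    have hd1 : Disjoint ({((1 - β₂ : ℝ) : ℂ), (β₂ : ℂ)} : Finset ℂ) Sp := by
      rw [Finset.disjoint_left]
      intro ρ hρ hρ'
      simp only [Finset.mem_insert, Finset.mem_singleton] at hρ
      simp only [hSp, Finset.mem_image] at hρ'
      obtain ⟨v, hv, rfl⟩ := hρ'
      have hv0 := (hSc hv).1
      rcases hρ with h | h
      · have := congrArg Complex.im h; simp at this; linarith
      · have := congrArg Complex.im h; simp at this; linarith
    have hd2 : Disjoint ({((1 - β₂ : ℝ) : ℂ), (β₂ : ℂ)} ∪ Sp) Sm := by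
      rw [Finset.disjoint_left]
      intro ρ hρ hρ'
      simp only [hSm, Finset.mem_image] at hρ'
      obtain ⟨v, hv, rfl⟩ := hρ'
      have hv0 := (hSc hv).1
      simp only [Finset.mem_union, Finset.mem_insert, Finset.mem_singleton, hSp, Finset.mem_image] at hρ
      rcases hρ with (h | h) | ⟨w, hw, h⟩
      · have := congrArg Complex.im h; simp at this; linarith
      · have := congrArg Complex.im h; simp at this; linarith
      · have := congrArg Complex.im h; simp at this; linarith [(hSc hw).1]
    have hpair : ({((1 - β₂ : ℝ) : ℂ), (β₂ : ℂ)} : Finset ℂ).card = 2 := by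
      rw [Finset.card_pair]
      intro h
      have := congrArg Complex.re h; simp at this; linarith
    rw [hS, Finset.card_union_of_disjoint hd2, Finset.card_union_of_disjoint hd1, hpair, hSp, hSm,
      Finset.card_image_of_injective _ hinj1, Finset.card_image_of_injective _ hinj2, hSccard]
    have : (((2 * m).toNat : ℕ) : ℤ) = 2 * m := Int.toNat_of_nonneg (by omega)
    push_cast
    omega
  -- pigeonhole: these are all the zeros, and all are simple
  have hcardZS : Zf.card ≤ S.card := by
    have h1 : (Zf.card : ℤ) ≤ 4 * m + 2 := hcard_le_sum.trans_eq hsumZ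
    omega
  have hZS : Zf = S := (Finset.eq_of_subset_of_card_le hSsub hcardZS).symm
  have hord1 : ∀ ρ ∈ Zf, (meromorphicOrderAt (epsteinP z) ρ).untop₀ = 1 := by
    have hle : ∀ ρ ∈ Zf, (0 : ℤ) ≤ (meromorphicOrderAt (epsteinP z) ρ).untop₀ - 1 :=
      fun ρ hρ ↦ by linarith [(hord ρ hρ).1]
    have hcardZ : (Zf.card : ℤ) = 4 * m + 2 := by rw [hZS]; exact hcard
    have hsum0 : ∑ ρ ∈ Zf, ((meromorphicOrderAt (epsteinP z) ρ).untop₀ - 1) = 0 := by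
      rw [Finset.sum_sub_distrib, hsumZ]
      simp only [Finset.sum_const, nsmul_eq_mul, mul_one]
      omega
    intro ρ hρ
    have := (Finset.sum_eq_zero_iff_of_nonneg hle).1 hsum0 ρ hρ
    linarith
  -- zeros of `Z` in the box are the points of `Zf`
  have hzero : ∀ s ∈ starkBox (starkK a b c), s ≠ 1 → Z s = 0 → s ∈ Zf := by
    intro s hs hs1 hZs
    rw [← hkK] at hs
    obtain ⟨hsre1, hsre2, hsim⟩ := hs
    have hP := (continuation_eq_zero_iff hQ z hre him hZ hsre1 hs1).1 hZs
    rw [hmemZf]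
    refine ⟨hP, ⟨hsre1, hsre2⟩, ?_, ?_⟩
    · refine lt_of_le_of_ne (by linarith [(abs_le.1 hsim).1]) fun h ↦ ?_
      apply hPb s.re ⟨hsre1.le, hsre2.le⟩
      have e : (s.re : ℂ) + ((-T₀ : ℝ) : ℂ) * I = s := by
        apply Complex.ext <;> simp [h]
      rw [e]; exact hP
    · refine lt_of_le_of_ne (by linarith [(abs_le.1 hsim).2]) fun h ↦ ?_
      apply hPt s.re ⟨hsre1.le, hsre2.le⟩
      have e : (s.re : ℂ) + (T₀ : ℂ) * I = s := by
        apply Complex.ext <;> simp [h]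
      rw [e]; exact hP
  refine ⟨fun s hs hs1 hZs ↦ ?_, ⟨1 - β₂, β₂, by linarith, by linarith, hβ₂, hβ₂', by ring, ?_, hZβ₂,
    fun s hs hs1 hZs ↦ ?_⟩⟩
  · -- simplicity
    have hsZf := hzero s hs hs1 hZs
    have hsre1 : -1 < s.re := by rw [← hkK] at hs; exact hs.1
    exact deriv_continuation_ne_zero hQ z hre him hZ hsre1 hs1 ((hmemZf s).1 hsZf).1
      ((hord s hsZf).2 (hord1 s hsZf))
  · -- `Z(β₁) = 0`
    exact (continuation_eq_zero_iff hQ z hre him hZ (s := ((1 - β₂ : ℝ) : ℂ)) (by simp; linarith)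
      (fun h ↦ by have := congrArg Complex.re h; simp at this; linarith)).2 hPβ₁
  · -- classification
    have hsZf := hzero s hs hs1 hZs
    rw [hZS, hS] at hsZf
    simp only [hSp, hSm, Finset.mem_union, Finset.mem_insert, Finset.mem_singleton, Finset.mem_image] at hsZf
    rcases hsZf with ((h | h) | ⟨v, -, rfl⟩) | ⟨v, -, rfl⟩
    · exact Or.inr (Or.inl h)
    · exact Or.inr (Or.inr h)
    · left; simp
    · left; simp

/-! ## The theorems -/

/-- **Stark 1967, Theorem 1 (PROVED; `K` ineffective).** There is `K` such that for every positive
definite `Q` with `k = √|d|/(2a) > K`, every analytic continuation `Z` of `ζ_Q` has only simple zeros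
in `−1 < σ < 2`, `|t| ≤ 2k` (`s ≠ 1`), all on `σ = ½` except two real zeros `β₁ = 1 − β₂ ∈ (0, ½)`,
`β₂ ∈ (½, 1)`. The proof replaces Stark's use of the Vinogradov zero-free region (Lemmas 1, 2, 4) by
the Lagarias–Suzuki inequality `|ξ(2s − 1)| < |ξ(2s)|` (`σ > ½`); `K` is obtained from
`k¹⁷e^{−(2/5)πk} → 0` and `log k → ∞` and is not made explicit. [cite: Stark1967EpsteinZeros, Theorem 1] -/
theorem Stark1967_thm1_holds : Stark1967_thm1 := by
  obtain ⟨c₀, hc0, hc0', hc₀⟩ := exists_norm_riemannZeta_ge_div_pow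
  obtain ⟨c₂, hc2, hc₂⟩ := exists_norm_riemannZeta_one_add_ge
  set η : ℝ := min (min (Real.exp (-(25 * π)) / 250) (2 * c₀ * (2 / 15 * π ^ (-(2 : ℝ))) * Real.exp (-(25 * π))))
    (min (c₀ ^ 2 * (2 / 15 * π ^ (-(2 : ℝ))) ^ 2 * Real.exp (-(25 * π)) ^ 2 / 22000)
      (4 * (c₂ * (2 / 15 * π ^ (-(1 / 2 : ℝ)))) * Real.exp (-π))) with hη
  have hη0 : 0 < η := by positivity
  have h1 : ∀ᶠ k : ℝ in atTop, 26 ≤ k := eventually_ge_atTop 26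
  have h2 : ∀ᶠ k : ℝ in atTop, 160 + 11 / 2 * π + 44 * Real.log 960 ≤ 6 * Real.log k := by
    filter_upwards [Real.tendsto_log_atTop.eventually_ge_atTop ((160 + 11 / 2 * π + 44 * Real.log 960) / 6)]
      with k hk
    linarith
  have h3 : ∀ᶠ k : ℝ in atTop, 48 * 8 ^ 17 * (k ^ (17 : ℝ) * Real.exp (-(2 / 5 * π) * k)) < η := by
    have ht := (tendsto_rpow_mul_exp_neg_mul_atTop_nhds_zero 17 (2 / 5 * π) (by positivity)).const_mul
      (48 * 8 ^ 17)
    rw [mul_zero] at ht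
    exact ht.eventually (Iio_mem_nhds hη0)
  obtain ⟨K, hK⟩ := Filter.eventually_atTop.1 (h1.and (h2.and h3))
  refine ⟨K, fun a b c hQ hKk Z hZ ↦ ?_⟩
  obtain ⟨h26, hlog, hG⟩ := hK (starkK a b c) hKk.le
  obtain ⟨z, hre, him, hk⟩ := exists_zQ' hQ
  rw [← hk] at h26 hlog hG
  obtain ⟨hL3, hL4, hL5, hL6⟩ := stark_ineqs (c₂ := c₂) hc0 h26 hG
  exact stark_main hc0 hc0' hc₀ hc2 hc₂ hQ z hre him hk h26 hlog hL3 hL4 hL5 hL6 hZ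

/-- **The barrier `EpsteinZetaRealZeros` holds**: Bateman–Grosswald's real zero in `(½, 1)` for
`k > 7.0556` (`Literature.Barriers.RiemannHypothesis.BatemanGrosswald1964_realZero_holds`) and
Stark's Theorem 1 (`Literature.Barriers.RiemannHypothesis.Stark1967_thm1_holds`).
[cite: BatemanGrosswald1964, Theorem 3] [cite: Stark1967EpsteinZeros, Theorem 1] -/
theorem EpsteinZetaRealZeros_holds : EpsteinZetaRealZeros :=
  ⟨BatemanGrosswald1964_realZero_holds, Stark1967_thm1_holds⟩

end Literature.Barriers.RiemannHypothesis
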